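import Mathlib
import HarnessLib
import Summits.CriticalPhenomena.PercolationContinuityZ3.Theses.PercTreeValue
import Literature.Probability.Percolation.TwoPointFunction

/-!
# Sketch — crux-ideate `stmt-CriticalPhenomena-7799` (`TetrahedronHarrisGap`), ideator 2

First lemmas (signatures only, no proofs required at this stage) for the two idea cards

* `harvested-covariance-four-arms` : `WindowHarrisSandwich`, `HarvestInequality`,
  `FourArmsFactorise`, transfer `ConditionalCovarianceGivenArms`, glue `HarvestAssembly`;
* `mirror-window-influence` : `WindowHarrisSandwich`, `InfluenceVariance`, `MirrorCoherence`,
  `InfluenceVarianceCriterion`, glue `MirrorAssembly`.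

Notation: `A_r = {0 ↔ a_r}`, `B_r = {b_r ↔ c_r}` with `a_r = (r,r,0)`, `b_r = (r,0,r)`,
`c_r = (0,r,r)`; `μc` = critical bond measure on `ℤ³`; for an edge window `F`,
`windowSigma F` is the σ-algebra generated by the coordinates in `F` and `μ[1_A | windowSigma F]`
the window-conditional probability of `A`.
-/

noncomputable section

namespace Summit.CriticalPhenomena.PercolationContinuityZ3.Cruxes.TetrahedronHarrisGap.Ideator2

open MeasureTheory
open Literature.Probability.Percolation Literature.Probability.LatticeModels
open Summit.CriticalPhenomena.PercolationContinuityZ3.Theses.PercTreeValue (TetrahedronHarrisGap)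

/-! ## Windows and window-conditional expectations -/

/-- σ-algebra on bond configurations generated by the coordinates in the edge window `F`
(pull-back of the product σ-algebra under `ω ↦ ω ∩ F`). -/
@[reducible] def windowSigma {V : Type*} (F : Set (Sym2 V)) : MeasurableSpace (Set (Sym2 V)) :=
  MeasurableSpace.comap (fun ω : Set (Sym2 V) => ω ∩ F) inferInstance

/-- `windowSigma F` is a sub-σ-algebra of the configuration σ-algebra. -/
theorem windowSigma_le {V : Type*} (F : Set (Sym2 V)) :
    windowSigma F ≤ (inferInstance : MeasurableSpace (Set (Sym2 V))) :=
  (measurable_set_iff.2 fun e => (measurable_set_mem e).and measurable_const).comap_le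

/-- **First lemma (both cards): the law of total covariance over a coordinate window is
sign-definite for increasing events.**  With `f = μ[1_A | σ_F]`, `g = μ[1_B | σ_F]`:
`μ(A) μ(B) ≤ ∫ f g dμ ≤ μ(A ∩ B)` — the left inequality is Harris for the increasing
window-measurable functions `f, g` (product structure of `σ_F`), the right one is Harris applied
conditionally on `σ_F` (the complement of the window is again a product measure).  Equivalently
`Cov(1_A,1_B) = E[Cov(1_A,1_B | σ_F)] + Cov(f, g)` with both terms `≥ 0`. -/
def WindowHarrisSandwich (V : Type*) : Prop :=
  ∀ (G : SimpleGraph V) (p : unitInterval) (F : Set (Sym2 V)) (A B : Set (BondConfig V)),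
    IsUpperSet A → IsUpperSet B → MeasurableSet A → MeasurableSet B →
      (bondPercolation G p).real A * (bondPercolation G p).real B ≤
          ∫ ω, ((bondPercolation G p)[A.indicator (fun _ => (1 : ℝ)) | windowSigma F]) ω *
               ((bondPercolation G p)[B.indicator (fun _ => (1 : ℝ)) | windowSigma F]) ω
            ∂(bondPercolation G p) ∧
      ∫ ω, ((bondPercolation G p)[A.indicator (fun _ => (1 : ℝ)) | windowSigma F]) ω *
           ((bondPercolation G p)[B.indicator (fun _ => (1 : ℝ)) | windowSigma F]) ω
          ∂(bondPercolation G p) ≤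
        (bondPercolation G p).real (A ∩ B)

/-! ## The critical tetrahedron -/

/-- The critical bond measure `P_{p_c}` on `ℤ³`. -/
abbrev μc : Measure (BondConfig (Site 3)) := bondPercolation (zdGraph 3) (criticalProbI 3)

/-- `a_r = (r, r, 0)`. -/
def vA (r : ℕ) : Site 3 := ![(r : ℤ), (r : ℤ), 0]
/-- `b_r = (r, 0, r)`. -/
def vB (r : ℕ) : Site 3 := ![(r : ℤ), 0, (r : ℤ)]
/-- `c_r = (0, r, r)`. -/
def vC (r : ℕ) : Site 3 := ![0, (r : ℤ), (r : ℤ)]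

/-- `A_r = {0 ↔ a_r}`. -/
def evA (r : ℕ) : Set (BondConfig (Site 3)) := openConn 0 (vA r)
/-- `B_r = {b_r ↔ c_r}`. -/
def evB (r : ℕ) : Set (BondConfig (Site 3)) := openConn (vB r) (vC r)

/-- `τ(0,a_r) · τ(b_r,c_r)` (the Harris product). -/
def tauProd (r : ℕ) : ℝ :=
  tau 3 (criticalProbI 3) 0 (vA r) * tau 3 (criticalProbI 3) (vB r) (vC r)

/-- The mirror `σ_r : x ↦ (r - x₀, x₁, r - x₂)`, a lattice isometry of `T_r` with
`σ 0 = b_r`, `σ a_r = c_r`, fixing the centroid; it swaps `A_r` and `B_r`. -/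
def mirror (r : ℕ) (x : Site 3) : Site 3 := ![(r : ℤ) - x 0, x 1, (r : ℤ) - x 2]

/-- Edge window: all edges with both endpoints within sup-distance `s` of one of the four vertices
of `T_r` (union of the four vertex boxes). -/
def boxesWindow (r s : ℕ) : Set (Sym2 (Site 3)) :=
  {e | ∃ v ∈ ({0, vA r, vB r, vC r} : Set (Site 3)), ∀ x ∈ e, ‖x - v‖ ≤ (s : ℝ)}

/-- Edge window: the central cube of half-side `q` around the centroid `(r/2, r/2, r/2)`
(`σ_r`-invariant; MC: carries little coherent influence for `q ≤ r/2.4`). -/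
def centralWindow (r q : ℕ) : Set (Sym2 (Site 3)) :=
  {e | ∀ x ∈ e, ∀ i : Fin 3, |2 * x i - (r : ℤ)| ≤ 2 * (q : ℤ)}

/-- Edge window: the coordinate slab `S₁(r,w) = {|2x₀ - r| ≤ 2w}` — `σ_r`-invariant AND doubly
separating (`0, c_r` have `x₀ = 0`; `a_r, b_r` have `x₀ = r`), so every `0–a_r` path and every
`b_r–c_r` path crosses it.  MC (kit j017372): `Var P(A_r|σ_{S₁}) ≈ 0.3 ττ` and
`corr(P(A_r|σ_{S₁}), P(B_r|σ_{S₁})) ≈ 0.3–0.4` for `w ≈ r/4`, `r = 8, 12, 16`. -/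
def slabWindow (r w : ℕ) : Set (Sym2 (Site 3)) :=
  {e | ∀ x ∈ e, |2 * x 0 - (r : ℤ)| ≤ 2 * (w : ℤ)}

/-- The translated box `v + Λ_s`. -/
def boxAt (v : Site 3) (s : ℕ) : Finset (Site 3) := (box 3 s).image (· + v)

/-- One-arm event at `v` to sup-distance `s`: `{v ↔ ∂(v + Λ_s) inside v + Λ_s}`. -/
def armAt (v : Site 3) (s : ℕ) : Set (BondConfig (Site 3)) :=
  {ω | ∃ y ∈ innerBoundary (zdGraph 3) (boxAt v s), ω ∈ openConnIn (↑(boxAt v s)) v y}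

/-- `F₄(r,s)`: all four vertices of `T_r` have an arm to sup-distance `s`. -/
def fourArms (r s : ℕ) : Set (BondConfig (Site 3)) :=
  armAt 0 s ∩ armAt (vA r) s ∩ armAt (vB r) s ∩ armAt (vC r) s

/-- Window-conditional probability of `A_r` given the window `F`: `μc[1_{A_r} | σ_F]`. -/
def condA (F : Set (Sym2 (Site 3))) (r : ℕ) : BondConfig (Site 3) → ℝ :=
  μc[(evA r).indicator (fun _ => (1 : ℝ)) | windowSigma F]

/-- Window-conditional probability of `B_r` given the window `F`. -/
def condB (F : Set (Sym2 (Site 3))) (r : ℕ) : BondConfig (Site 3) → ℝ :=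
  μc[(evB r).indicator (fun _ => (1 : ℝ)) | windowSigma F]

/-- The **harvested covariance** of the window `F`: `E[Cov(1_A, 1_B | σ_F)] = μ(A∩B) - ∫ f g`. -/
def harvested (F : Set (Sym2 (Site 3))) (r : ℕ) : ℝ :=
  μc.real (evA r ∩ evB r) - ∫ ω, condA F r ω * condB F r ω ∂μc

/-! ## Card `harvested-covariance-four-arms` -/

/-- **Card 1, first lemma (BK pays the four arms).** For `2s + 2 ≤ r` the four vertex boxes are
disjoint and `τ(0,a_r) ≤ P(arm₀ ∩ arm_a) = π(s)²` (first exit + independence of disjoint boxes), so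
`τ τ ≤ π(s)⁴`; combined with `Cov(1_A,1_B) ≥ harvested ≥ 0` (`WindowHarrisSandwich`) this gives
`(μ(A∩B) - ττ) · π(s)⁴ ≥ harvested(boxes) · ττ`, i.e. `H_r - 1 ≥ harvested(boxes)/π(s)⁴`. -/
def HarvestInequality : Prop :=
  ∀ r s : ℕ, 2 * s + 2 ≤ r →
    harvested (boxesWindow r s) r * tauProd r ≤
      (μc.real (evA r ∩ evB r) - tauProd r) * μc.real (siteToBoundary 3 s) ^ 4

/-- **Card 1, support.** The four arm events live in disjoint boxes and are translates of
`{0 ↔ ∂Λ_s}`: `μc(F₄(r,s)) = π(s)⁴` for `2s + 2 ≤ r`; and the harvested covariance of the boxes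
window is carried by `F₄` (off `F₄` one of `A_r, B_r` is impossible given the boxes). -/
def FourArmsFactorise : Prop :=
  ∀ r s : ℕ, 2 * s + 2 ≤ r →
    μc.real (fourArms r s) = μc.real (siteToBoundary 3 s) ^ 4 ∧
    harvested (boxesWindow r s) r =
      ∫ ω in fourArms r s, ((μc[(evA r ∩ evB r).indicator (fun _ => (1 : ℝ)) |
          windowSigma (boxesWindow r s)]) ω - condA (boxesWindow r s) r ω * condB (boxesWindow r s) r ω) ∂μc

/-- **Card 1, transfer `C⁺` = `B*`: non-degenerate conditional covariance given four arms.**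
With boxes of radius `s = r/4`: conditionally on the four box configurations, the residual
covariance of the two pairing connections over the fresh outside is, on average over armed box
data, at least `δ`:  `E[Cov(1_A,1_B | σ_boxes)] ≥ δ · μc(F₄)`.  Absolute (not relative),
lives on `O(1)`-probability events of an exact product measure; fails in every jump world. -/
def ConditionalCovarianceGivenArms : Prop :=
  ∃ δ : ℝ, 0 < δ ∧ ∃ r₀ : ℕ, ∀ r : ℕ, r₀ ≤ r →
    δ * μc.real (fourArms r (r / 4)) ≤ harvested (boxesWindow r (r / 4)) r

/-- Glue of card 1 (two lines of algebra: divide `HarvestInequality` by `π(r/4)⁴ > 0`). -/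
def HarvestAssembly : Prop :=
  HarvestInequality → FourArmsFactorise → ConditionalCovarianceGivenArms → TetrahedronHarrisGap

/-! ## Card `mirror-window-influence` -/

/-- **Card 2, crux K1: relative influence variance of the midway slab does not vanish.**
`Var(P(A_r | σ_{S₁})) ≥ c · τ(0,a_r)²` for the mirror-invariant separating slab `S₁(r, r/κ)`.
A one-event, exponent-free statement; in a jump world the left side is `o(τ²)`
(`{0 ∈ C_∞}` is asymptotically local and the slab recedes from `0, a_r`), so K1 alone implies
`θ(p_c) = 0` (`InfluenceVarianceCriterion`). -/
def InfluenceVariance : Prop :=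
  ∃ c : ℝ, 0 < c ∧ ∃ κ : ℕ, 2 < κ ∧ ∃ r₀ : ℕ, ∀ r : ℕ, r₀ ≤ r →
    c * tau 3 (criticalProbI 3) 0 (vA r) ^ 2 ≤
      ∫ ω, condA (slabWindow r (r / κ)) r ω ^ 2 ∂μc - μc.real (evA r) ^ 2

/-- **Card 2, crux K2: mirror coherence.** The influences of the slab on `A_r` and on its mirror
image `B_r = σ_r A_r` are positively correlated by a constant factor:
`Cov(f, f ∘ σ) ≥ c · Var f` for `f = P(A_r | σ_{S₁})` (note `P(B_r | σ_{S₁}) = f ∘ σ_r` since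
`S₁` and `μc` are `σ_r`-invariant); equivalently `Var(f_anti) ≤ (1 - c) Var(f_sym)`. -/
def MirrorCoherence : Prop :=
  ∃ c : ℝ, 0 < c ∧ ∀ κ : ℕ, 2 < κ → ∃ r₀ : ℕ, ∀ r : ℕ, r₀ ≤ r →
    c * (∫ ω, condA (slabWindow r (r / κ)) r ω ^ 2 ∂μc - μc.real (evA r) ^ 2) ≤
      ∫ ω, condA (slabWindow r (r / κ)) r ω * condB (slabWindow r (r / κ)) r ω ∂μc -
        μc.real (evA r) * μc.real (evB r)

/-- **Card 2, jump-side lemma (provable now):** `InfluenceVariance` alone decides the conjunct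
(in a jump world `P(A_r | σ_{S₁}) → θ(p_c)²` in `L²` by `2`-fold mixing while `τ → θ(p_c)² > 0`). -/
def InfluenceVarianceCriterion : Prop :=
  InfluenceVariance → _root_.PercolationContinuityZ3

/-- Glue of card 2: `Cov(1_A,1_B) ≥ Cov(f, f∘σ) ≥ c · Var f ≥ c c' τ²` and `τ(b_r,c_r) = τ(0,a_r)`
(lattice symmetry), i.e. `WindowHarrisSandwich → InfluenceVariance → MirrorCoherence → crux`. -/
def MirrorAssembly : Prop :=
  WindowHarrisSandwich (Site 3) → InfluenceVariance → MirrorCoherence → TetrahedronHarrisGap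

end Summit.CriticalPhenomena.PercolationContinuityZ3.Cruxes.TetrahedronHarrisGap.Ideator2

end
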